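import Summits.ABC.ABC.Theorems.DefiniteXiSteinbergCoreXiDegreeComparison
import Summits.ABC.ABC.Theorems.DefiniteXiDefiniteRTControlPrime
import Summits.ABC.ABC.Theorems.DefiniteXiXiBoundUpgradeSharpening
import HarnessLib

/-!
# Crux `XiStrongBound` (stmt-ABC-11337), route DefiniteXi — the FULL-RUNG DEGREE CALIBRATION:
# `ξ(N/N⁻, N⁻) ≤ 163^{ω(N⁻)} · ∏_{q ∣ N⁻} v_q(Δ_min) · deg D` at EVERY admissible `N⁻` and every
# datum `D`, and `XiStrongBound ⟺ FreyDegreeBound` modulo Takahashi's Thm. 2.3 for Shimura curves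

The crux `XiStrongBound` (r4) bounds `ξ(E_{a,b}; N/Nm, Nm) · ∏_{q ∣ Nm} v_q(Δ_min(E_{a,b})) ≤ C_ε N^{2+ε}`
for EVERY admissible `Nm` (odd, squarefree, `ω(Nm)` odd, `Nm ∣ N`; `ξ = brandtXi`).  Its prime rung
was calibrated against the thesis `X = FreyDegreeBound` in
`DefiniteXiXiStrongBoundPrimeCalibration.lean`; the item's "why it might fail" left one clause open:
*"Risk beyond abc: if `N/Nm` has no odd prime, abc ⟹ this is unproved (`den γ ≤ κ^ω·D` only, Pasten
6.1 (a); cokernels `j_p > 1` occur)."*  This file closes that clause modulo printed theorems: the UPPER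
bound the crux asks for uses, in Takahashi's systems `δ i = h j`, `i j = c`, only `i ≤ c` and `j ≥ 1`
— never a bound on cokernels or on the Eisenstein unit `γ` — so the composite-`Nm` instances (corner
`N/Nm = 2^k` included) follow from `X` with the loss `163^{ω(Nm)} · (∏_{q∣Nm} v_q(Δ_min))²`, which is
`N^{o(1)}` under `PolyFreyDegree ⟸ X` (landed `prod_factorization_le_rpow_of_polyFreyDegree`).

Contents: `le_of_level_system`, `le_of_two_systems` (the steps in `ℕ`, full degrees; the landed
`XiDegreeComparison.primeToSix_le_of_…` are their prime-to-`6` shadows); `deg_le_telescope` (Pasten's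
§6.9 telescoping in Brandt coordinates under `hTlev`, `hT2` — VERBATIM the hypotheses of
`Literature/…/ShimuraCurveRibetTakahashiBrandtCoordinatesProofs.lean` and of the landed
`xiDegreeComparison_of_facts`, p139336 — Lemma 6.8 `h68` and Jacquet–Langlands data `hJL`);
`brandtXi_le_deg_mul_prod` / `brandtXi_mul_prod_le` (**the pointwise comparison at every admissible
`Nm` and every datum**); `xiStrongBound_of_freyDegreeBound_of_facts` (**`X ⟹ XiStrongBound`**);
`xiStrongBound_iff_freyDegreeBound_of_facts` (**`XiStrongBound ⟺ X`**, the converse being the landed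
prime-rung chain (E₃), (E₁), `minimalBoundGivesTarget_proof` with the route items
`DefiniteRTControlPrime`, `FreyModularity`); `xiStrongBound_iff_primeXiStrongBound_of_facts` (the full
crux is equivalent to its prime rung: the composite-`Nm` instances are idle AND harmless).  Reading for
the line programme: the crux is EXACTLY thesis-strength at every rung; no line below `X` closes it,
and no composite-level phenomenon (2-adic depth of `ξ`, cokernels, Eisenstein units) refutes it
without refuting `X`.

## References

* [Takahashi2001] S. Takahashi, Degrees of parametrizations of elliptic curves by Shimura curves,
  J. Number Theory 90 (2001) 74–88: Thm. 2.3 (p. 79), p. 80, Prop. 3.1 / Thm. 3.2 (a) (p. 82), p. 84.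
* [PastenShimura2024] H. Pasten, Shimura curves and the abc conjecture, J. Number Theory 254 (2024)
  = arXiv:1705.09251: Lemma 6.8 (p. 22), Prop. 6.13 (p. 23), §6.9 (p. 25), Thm. 6.1 (p. 20).
* [RibetTakahashi1997] K. A. Ribet, S. Takahashi, PNAS 94 (1997) 11110–11114, Thm. 2.
* [Masser1990] D. W. Masser, Note on a conjecture of Szpiro, Astérisque 183 (1990) — exponent 2 sharp.
-/

set_option linter.dupNamespace false

noncomputable section
namespace Summit.ABC.ABC.Theorems.DefiniteXiXiStrongBoundDegreeCalibration

open Summit.ABC.ABC.Theses.DefiniteXi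
open Literature.NumberTheory.EllipticCurves Literature.NumberTheory.EllipticCurves.ModularForms
open Literature.NumberTheory.Automorphic
open WeierstrassCurve
open Summit.ABC.ABC.Theorems.XiDegreeComparison (exists_pow_card_primeFactors_le)

/-! ## (1) The two steps in `ℕ`, full degrees -/

/-- **Top step.** From Takahashi's system `δ i = ξ j`, `i j = c`, `0 < δ`, `0 < i`:
`ξ ≤ δ · c` (`j ≥ 1`, so `ξ ≤ ξ j = δ i ≤ δ i j = δ c`). [cite: Takahashi2001, Thm. 2.3 (p. 79)] -/
theorem le_of_level_system {δ ξ i j c : ℕ} (hδ : 0 < δ) (hi : 0 < i)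
    (hc : i * j = c) (h : δ * i = ξ * j) : ξ ≤ δ * c := by
  obtain ⟨hj, -⟩ := pos_of_thm_2_3 hδ hi h
  calc ξ ≤ ξ * j := Nat.le_mul_of_pos_right _ hj
    _ = δ * i := h.symm
    _ ≤ δ * c := Nat.mul_le_mul_left _ (hc ▸ Nat.le_mul_of_pos_right _ hj)

/-- **Two-prime step** (Ribet–Takahashi's Thm. 2 = Pasten's Prop. 6.13 in Brandt coordinates, full
degrees): the level system `δ₁ i₁ = h j₁`, `i₁ j₁ = c₁` and the discriminant system `δ₂ i₂ = h j₂`,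
`i₂ j₂ = c₂` with the SAME `h` give `δ₂ (i₂ j₁) = δ₁ (i₁ j₂)`, whence `δ₂ ≤ δ₁ · c₁ c₂`.
[cite: Takahashi2001, Thm. 2.3 (p. 79) and Thm. 3.2 (a) (p. 82)] [cite: PastenShimura2024, Prop. 6.13 p. 23] -/
theorem le_of_two_systems {δ₁ δ₂ h i₁ j₁ i₂ j₂ c₁ c₂ : ℕ} (hδ₁ : 0 < δ₁)
    (hi₁ : 0 < i₁) (hi₂ : 0 < i₂) (hc₁ : i₁ * j₁ = c₁) (hc₂ : i₂ * j₂ = c₂)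
    (h₁ : δ₁ * i₁ = h * j₁) (h₂ : δ₂ * i₂ = h * j₂) : δ₂ ≤ δ₁ * (c₁ * c₂) := by
  obtain ⟨hj₁, -⟩ := pos_of_thm_2_3 hδ₁ hi₁ h₁
  have key : δ₂ * (i₂ * j₁) = δ₁ * (i₁ * j₂) := by
    calc δ₂ * (i₂ * j₁) = δ₂ * i₂ * j₁ := by ring
      _ = h * j₁ * j₂ := by rw [h₂]; ring
      _ = δ₁ * (i₁ * j₂) := by rw [← h₁]; ring
  have hi₁c : i₁ ≤ c₁ := hc₁ ▸ Nat.le_mul_of_pos_right _ hj₁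
  have hj₂c : j₂ ≤ c₂ := hc₂ ▸ Nat.le_mul_of_pos_left _ hi₂
  calc δ₂ ≤ δ₂ * (i₂ * j₁) := Nat.le_mul_of_pos_right _ (Nat.mul_pos hi₂ hj₁)
    _ = δ₁ * (i₁ * j₂) := key
    _ ≤ δ₁ * (c₁ * c₂) := Nat.mul_le_mul_left _ (Nat.mul_le_mul hi₁c hj₂c)

/-! ## (2) Section hypotheses: Takahashi's Thm. 2.3 for `X₀^D(M)` at `p ∥ M` (`hTlev`, level side, Brandt type
`(M/p, Dp)`) and at `p ∣ D` (`hT2`, discriminant side with Thm. 3.2 (a), type `(pM, D/p)`); Lemma 6.8; JL data -/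

section Takahashi

variable
  (hTlev : ∀ {N D M p m : ℕ}, p.Prime → M = p * m → ¬ p ∣ m → IsAdmissibleFactorization N D M →
    ∀ (X : ShimuraCurveData D M) (W : WeierstrassCurve ℚ) [W.IsElliptic], W.conductorNorm ℤ = N →
    ∀ (W' : WeierstrassCurve ℚ) [W'.IsElliptic] (P : ShimuraParametrizationData X W'),
      P.IsMinimalFor W →
    ∀ S : Brandt.XiSetup m (D * p),
      ∃ i j : ℕ, 0 < i ∧ i * j = (W'.minimalDiscriminantNorm ℤ).factorization p ∧
        i ∣ S.xi (fun n => W'.LFunction n) ∧ P.deg * i = S.xi (fun n => W'.LFunction n) * j)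
  (hT2 : ∀ {N D M p d : ℕ}, p.Prime → D = p * d → IsAdmissibleFactorization N D M →
    ∀ (X : ShimuraCurveData D M) (W : WeierstrassCurve ℚ) [W.IsElliptic], W.conductorNorm ℤ = N →
    ∀ (W' : WeierstrassCurve ℚ) [W'.IsElliptic] (P : ShimuraParametrizationData X W'),
      P.IsMinimalFor W →
    ∀ S : Brandt.XiSetup (p * M) d,
      ∃ i j : ℕ, 0 < i ∧ i * j = (W'.minimalDiscriminantNorm ℤ).factorization p ∧
        i ∣ S.xi (fun n => W'.LFunction n) ∧ P.deg * i = S.xi (fun n => W'.LFunction n) * j)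
  (h68 : PastenShimura2024_lemma_6_8) (hJL : nonempty_shimuraParametrizationData)

include hTlev hT2 h68 hJL

/-- **The telescoping (Pasten §6.9 in Brandt coordinates), full degrees**: for a global minimal model
`W ∼ E`, the class-minimal classical datum `D₀` and every admissible `N = DM`, `D` odd, `ω(D) = 2n`,
a class-minimal Shimura datum `P` on `X₀^D(M)` has `deg P ≤ (163²)^n · ∏_{q ∣ D} v_q(Δ_min E) · deg D₀`
(induction: two primes `p ≠ r` of `D`, common Brandt type `(rM, dp)`, `le_of_two_systems`, Lemma 6.8).
[cite: PastenShimura2024, §6.9 p. 25 and Prop. 6.13 p. 23] [cite: Takahashi2001, Thm. 2.3 (p. 79), Thm. 3.2 (a) (p. 82), p. 84] -/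
theorem deg_le_telescope
    {a b : ℤ} (hab : IsCoprime a b) (h0 : a * b * (a + b) ≠ 0) {N : ℕ} [NeZero N]
    (hN : (freyCurve a b).conductorNorm ℤ = N)
    (W : WeierstrassCurve ℚ) [W.IsElliptic] [W.IsGloballyMinimal] (hWN : W.conductorNorm ℤ = N)
    (hEW : (freyCurve a b).IsIsogenous W)
    {W₀ : WeierstrassCurve ℚ} [W₀.IsElliptic] (D₀ : ModularParametrizationData W₀ N)
    (hf₀ : IsNewformOf W D₀.f)
    (hmin₀ : ∀ (W₂ : WeierstrassCurve ℚ) [W₂.IsElliptic] (D₂ : ModularParametrizationData W₂ N),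
      D₂.f = D₀.f → D₀.modularDegree ≤ D₂.modularDegree) :
    ∀ (n : ℕ) {D M : ℕ}, IsAdmissibleFactorization N D M → D.primeFactors.card = 2 * n →
      ¬ 2 ∣ D →
    ∀ (X : ShimuraCurveData D M) (W' : WeierstrassCurve ℚ) [W'.IsElliptic]
      (P : ShimuraParametrizationData X W'), P.IsMinimalFor W →
      P.deg ≤ (163 * 163) ^ n *
          (∏ q ∈ D.primeFactors, ((freyCurve a b).minimalDiscriminantNorm ℤ).factorization q) *
          D₀.modularDegree := by
  haveI := isElliptic_freyCurve h0
  intro n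
  induction n with
  | zero =>
    intro D M hadm hcard _ X W' _ P hP
    have h1 : D.primeFactors = ∅ := Finset.card_eq_zero.mp (by omega)
    have hD : D = 1 := (Nat.primeFactors_eq_empty.mp h1).resolve_left hadm.squarefree.ne_zero
    subst hD
    obtain rfl : M = N := by simpa using hadm.mul_eq
    simp [hP.deg_eq_modularDegree D₀ hf₀ hmin₀]
  | succ n ih =>
    intro D M hadm hcard hD2 X W' _ P hP
    -- two primes `p ≠ r` of `D`, `d = D/(pr)`
    obtain ⟨p, hp⟩ : D.primeFactors.Nonempty := Finset.card_pos.mp (by omega)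
    obtain ⟨r, hr⟩ : (D.primeFactors.erase p).Nonempty :=
      Finset.card_pos.mp (by rw [Finset.card_erase_of_mem hp]; omega)
    obtain ⟨hrp, hr⟩ := Finset.mem_erase.mp hr
    have hpp := Nat.prime_of_mem_primeFactors hp; have hrr := Nat.prime_of_mem_primeFactors hr
    have hpD := Nat.dvd_of_mem_primeFactors hp; have hrD := Nat.dvd_of_mem_primeFactors hr
    obtain ⟨hDd, hadm₁, hdisj, hpf⟩ := hadm.erase_two_primes hpp hrr (Ne.symm hrp) hpD hrD
    set d := D / (p * r) with hd
    have hcard₁ : d.primeFactors.card = 2 * n := by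
      have : D.primeFactors.card = d.primeFactors.card + 2 := by
        rw [hpf, Finset.card_union_of_disjoint hdisj, Finset.card_pair (Ne.symm hrp)]
      omega
    have hd2 : ¬ 2 ∣ d := fun h2 => hD2 (h2.trans ⟨p * r, hDd⟩)
    have hDN : D ∣ (freyCurve a b).conductorNorm ℤ := by rw [hN]; exact ⟨M, hadm.mul_eq.symm⟩
    have hp2 : p ≠ 2 := fun h => hD2 (h ▸ hpD); have hr2 : r ≠ 2 := fun h => hD2 (h ▸ hrD)
    -- the curve `X₀^d(prM)` and a class-minimal datum `P₁` on it; induction hypothesis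
    obtain ⟨X₁⟩ := nonempty_shimuraCurveData_holds hadm₁
    obtain ⟨W₁', hW₁', P₁, hP₁⟩ :=
      ShimuraParametrizationData.exists_isMinimalFor_of_nonempty (hJL hadm₁ X₁ W hWN)
    have ih₁ := ih hadm₁ hcard₁ hd2 X₁ W₁' P₁ hP₁
    -- the common Brandt setup of type `(r M, d p)`; level side at `p`, discriminant side at `r`
    have hDr : D = r * (d * p) := by rw [hDd]; ring
    obtain ⟨S⟩ := hadm.nonempty_xiSetup_disc hrr hDr
    have hpm : ¬ p ∣ r * M := (Nat.Prime.coprime_iff_not_dvd hpp).mp (Nat.Coprime.mul_right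
      ((Nat.coprime_primes hpp hrr).mpr (Ne.symm hrp)) (Nat.Coprime.coprime_dvd_left hpD hadm.coprime))
    obtain ⟨i₁, j₁, hi₁, hc₁, -, hδ₁⟩ := hTlev hpp (by ring : p * r * M = p * (r * M)) hpm hadm₁ X₁ W hWN W₁' P₁ hP₁ S
    obtain ⟨i₂, j₂, hi₂, hc₂, -, hδ₂⟩ := hT2 hrr hDr hadm X W hWN W' P hP S
    -- the same eigenvalues `a(W₁') = a(W) = a(W')`, and the step in `ℕ`
    have hL₁ : (fun n => W₁'.LFunction n) = fun n => W.LFunction n := by funext n; rw [hP₁.1.LFunction_eq]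
    have hL₂ : (fun n => W'.LFunction n) = fun n => W.LFunction n := by funext n; rw [hP.1.LFunction_eq]
    rw [hL₁] at hδ₁; rw [hL₂] at hδ₂
    have hstep := le_of_two_systems P₁.deg_pos hi₁ hi₂ hc₁ hc₂ hδ₁ hδ₂
    -- `c_p(A₁) ≤ 163 c_p(E)`, `c_r(A₂) ≤ 163 c_r(E)` (Pasten Lemma 6.8)
    have hT := DefiniteRTControlPrime.stub_valTransport h68 a b hab h0
    have hvp := hT p hpp hp2 (hpD.trans hDN) W₁' (hEW.trans' hP₁.1)
    have hvr := hT r hrr hr2 (hrD.trans hDN) W' (hEW.trans' hP.1)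
    -- assemble
    set V := ∏ q ∈ d.primeFactors, ((freyCurve a b).minimalDiscriminantNorm ℤ).factorization q
    set vp := ((freyCurve a b).minimalDiscriminantNorm ℤ).factorization p
    set vr := ((freyCurve a b).minimalDiscriminantNorm ℤ).factorization r
    have hprod : ∏ q ∈ D.primeFactors, ((freyCurve a b).minimalDiscriminantNorm ℤ).factorization q
        = V * (vp * vr) := by
      rw [hpf, Finset.prod_union hdisj, Finset.prod_pair (Ne.symm hrp)]
    rw [hprod]
    calc P.deg
        ≤ P₁.deg * ((W₁'.minimalDiscriminantNorm ℤ).factorization p *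
              (W'.minimalDiscriminantNorm ℤ).factorization r) := hstep
      _ ≤ (163 * 163) ^ n * V * D₀.modularDegree * ((163 * vp) * (163 * vr)) :=
          Nat.mul_le_mul ih₁ (Nat.mul_le_mul hvp hvr)
      _ = (163 * 163) ^ (n + 1) * (V * (vp * vr)) * D₀.modularDegree := by ring

/-- **`ξ(N/Nm, Nm)(a(E_{a,b})) ≤ 163^{ω(Nm)} · ∏_{q ∣ Nm} v_q(Δ_min E_{a,b}) · deg D` for EVERY
admissible (possibly composite) `Nm` and EVERY datum `D` of the Frey model at level `N`**, on `hTlev`,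
`hT2`, Lemma 6.8, Jacquet–Langlands data.  Chain (`r ∣ Nm` prime, `P` class-minimal on
`X₀^{Nm/r}(r·N/Nm)`, `D₀` lattice-optimal, `deg D₀ ∣ deg D`): TOP `deg P · i = ξ j`, `i j = c_r(A) ≤ 163 c_r(E)`;
TELESCOPE `deg P ≤ (163²)^k ∏_{q ∣ Nm/r} v_q · deg D₀`; BOTTOM `deg D₀ ≤ deg D`.  No minimality of `D`,
no `FreyModularity`, no bound on cokernels or Eisenstein units is used.
[cite: Takahashi2001, Thm. 2.3 (p. 79), Thm. 3.2 (a) (p. 82), p. 84] [cite: PastenShimura2024, Lemma 6.8 p. 22, §6.9 p. 25] -/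
theorem brandtXi_le_deg_mul_prod
    {a b : ℤ} (hab : IsCoprime a b) (h0 : a * b * (a + b) ≠ 0) {N : ℕ} [NeZero N]
    (hN : (freyCurve a b).conductorNorm ℤ = N) {Nm : ℕ} (hodd : Odd Nm) (hsq : Squarefree Nm)
    (hcard : Odd Nm.primeFactors.card) (hNmN : Nm ∣ N)
    (D : ModularParametrizationData (freyCurve a b) N) :
    brandtXi (N / Nm) Nm (fun n => (freyCurve a b).LFunction n) ≤
      163 ^ Nm.primeFactors.card *
        (∏ q ∈ Nm.primeFactors, ((freyCurve a b).minimalDiscriminantNorm ℤ).factorization q) *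
        D.deg := by
  haveI := isElliptic_freyCurve h0
  -- the lattice-optimal datum `D₀` of the newform of `D`, `deg D₀ ∣ deg D`
  obtain ⟨W₀, hW₀, D₀, hf₀, h₀⟩ := D.exists_optimalDatum'
  haveI := hW₀
  have hker₀ : D₀.isogenyMap.ker = ⊥ := D₀.isogenyMap_ker_eq_bot_iff.mpr h₀
  have hmin₀ : ∀ (W₂ : WeierstrassCurve ℚ) [W₂.IsElliptic] (D₂ : ModularParametrizationData W₂ N),
      D₂.f = D₀.f → D₀.modularDegree ≤ D₂.modularDegree := fun W₂ _ D₂ hD₂ =>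
    D₀.modularDegree_le_of_isogenyMap_ker_eq_bot hker₀ D₂ hD₂
  have hD₀D : D₀.modularDegree ≤ D.deg := by
    have hinj : Function.Injective D₀.isogenyMap := (AddMonoidHom.ker_eq_bot_iff _).mp hker₀
    obtain ⟨_, hdeg⟩ := D.modularDegree_eq_card_ker_mul hf₀.symm D₀.smul_periodLattice_le hinj
      D₀.deg_pos D₀.finite_setOf_natCard_fiberOrbits_ne
    exact Nat.le_of_dvd D.deg_pos ⟨_, hdeg.trans (mul_comm _ _)⟩
  -- a global minimal model `W = Cv • E` of the Frey curve
  obtain ⟨Cv, hCv⟩ := hasGlobalMinimalModel_rat_holds (freyCurve a b)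
  haveI := hCv
  have hWN : (Cv • freyCurve a b).conductorNorm ℤ = N := by rw [conductorNorm_smul_rat, hN]
  have hEW : (freyCurve a b).IsIsogenous (Cv • freyCurve a b) := isIsogenous_smul _ Cv
  have hfW : IsNewformOf (Cv • freyCurve a b) D₀.f := by
    rw [hf₀]; exact D.isNewformOf.of_isIsogenous hEW.symm_of_charZero
  -- a Brandt setup of type `(N/Nm, Nm)` exists on the domain; a prime `r ∣ Nm`; admissibility
  obtain ⟨S₀⟩ : Nonempty (Brandt.XiSetup (N / Nm) Nm) := by
    have h := XiBound.Negative.nonempty_xiSetup_freyCurve hab h0 hodd hsq hcard (hN ▸ hNmN)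
    rwa [hN] at h
  obtain ⟨-, -, -, hcop⟩ := Brandt.nonempty_xiSetup_iff_admissible.mp ⟨S₀⟩
  have hNm1 : Nm ≠ 1 := by rintro rfl; simp at hcard
  obtain ⟨r, hr, hrNm⟩ := Nat.exists_prime_and_dvd hNm1
  set Np := N / Nm with hNp
  set D' := Nm / r with hD'
  have hNmr : D' * r = Nm := Nat.div_mul_cancel hrNm
  have hN' : Np * Nm = N := Nat.div_mul_cancel hNmN
  obtain ⟨hD'r, hsqD', -⟩ : D'.Coprime r ∧ Squarefree D' ∧ Squarefree r := by
    rw [← Nat.squarefree_mul_iff, hNmr]; exact hsq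
  have hpfNm : Nm.primeFactors = D'.primeFactors ∪ {r} := by
    rw [← hNmr, hD'r.primeFactors_mul, hr.primeFactors]
  have hdisj : Disjoint D'.primeFactors {r} := hr.primeFactors ▸ hD'r.disjoint_primeFactors
  have hcardNm : Nm.primeFactors.card = D'.primeFactors.card + 1 := by
    rw [hpfNm, Finset.card_union_of_disjoint hdisj, Finset.card_singleton]
  obtain ⟨k, hk⟩ : Even D'.primeFactors.card := hcard.elim fun m hm => ⟨m, by omega⟩
  have hadm : IsAdmissibleFactorization N D' (r * Np) :=
    ⟨NeZero.pos N, by rw [← hN', ← hNmr]; ring, hsqD', ⟨k, hk⟩,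
      Nat.Coprime.mul_right hD'r (hcop.symm.coprime_dvd_left (Nat.div_dvd_of_dvd hrNm))⟩
  have hrNp : ¬ r ∣ Np :=
    (Nat.Prime.coprime_iff_not_dvd hr).mp (Nat.Coprime.coprime_dvd_left hrNm hcop.symm)
  -- the Shimura curve `X₀^{D'}(r·Np)` and a class-minimal datum `P` of `W` on it
  obtain ⟨X⟩ := nonempty_shimuraCurveData_holds hadm
  obtain ⟨W', hW', P, hP⟩ := ShimuraParametrizationData.exists_isMinimalFor_of_nonempty
    (hJL hadm X (Cv • freyCurve a b) hWN)
  haveI := hW'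
  -- TOP: Thm. 2.3 on `X₀^{D'}(r·Np)` at `r ∥ r·Np`, Brandt type `(Np, D' r) = (Np, Nm)`
  have key : ∀ K : ℕ, D' * r = K → ∀ S : Brandt.XiSetup Np K, ∃ i j : ℕ, 0 < i ∧
      i * j = (W'.minimalDiscriminantNorm ℤ).factorization r ∧
      P.deg * i = brandtXi Np K (fun n => W'.LFunction n) * j := by
    intro K hK S; subst hK
    obtain ⟨i, j, hi, hc, -, hδ⟩ := hTlev hr rfl hrNp hadm X (Cv • freyCurve a b) hWN W' P hP S
    exact ⟨i, j, hi, hc, by rw [S.brandtXi_eq_xi]; exact hδ⟩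
  obtain ⟨i, j, hi, hc, hδ⟩ := key Nm hNmr S₀
  have hL : (fun n => W'.LFunction n) = fun n => (freyCurve a b).LFunction n := by funext n; rw [(hEW.trans' hP.1).LFunction_eq]
  rw [hL] at hδ
  have htop := le_of_level_system P.deg_pos hi hc hδ
  have hr2 : r ≠ 2 := fun h => (Nat.not_even_iff_odd.mpr hodd) (even_iff_two_dvd.mpr (h ▸ hrNm))
  have hrN : r ∣ (freyCurve a b).conductorNorm ℤ := by rw [hN]; exact hrNm.trans hNmN
  have hvr := DefiniteRTControlPrime.stub_valTransport h68 a b hab h0 r hr hr2 hrN W' (hEW.trans' hP.1)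
  -- TELESCOPE down to `(1, N)`
  have hD'2 : ¬ 2 ∣ D' := fun h => (Nat.not_even_iff_odd.mpr hodd) (even_iff_two_dvd.mpr (h.trans (Nat.div_dvd_of_dvd hrNm)))
  have htel := deg_le_telescope hTlev hT2 h68 hJL hab h0 hN (Cv • freyCurve a b) hWN hEW D₀ hfW hmin₀ k hadm (by omega) hD'2 X W' P hP
  -- the chain in `ℕ`
  set V' := ∏ q ∈ D'.primeFactors, ((freyCurve a b).minimalDiscriminantNorm ℤ).factorization q
  set vr := ((freyCurve a b).minimalDiscriminantNorm ℤ).factorization r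
  have hTNm_eq : ∏ q ∈ Nm.primeFactors, ((freyCurve a b).minimalDiscriminantNorm ℤ).factorization q
      = V' * vr := by rw [hpfNm, Finset.prod_union hdisj, Finset.prod_singleton]
  rw [hTNm_eq]
  calc brandtXi Np Nm (fun n => (freyCurve a b).LFunction n)
      ≤ P.deg * (W'.minimalDiscriminantNorm ℤ).factorization r := htop
    _ ≤ (163 * 163) ^ k * V' * D₀.modularDegree * (163 * vr) := Nat.mul_le_mul htel hvr
    _ ≤ (163 * 163) ^ k * V' * D.deg * (163 * vr) :=
        Nat.mul_le_mul_right _ (Nat.mul_le_mul_left _ hD₀D)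
    _ = 163 ^ (k + k + 1) * (V' * vr) * D.deg := by
        rw [show (163 * 163 : ℕ) ^ k = 163 ^ (k + k) by rw [mul_pow, ← pow_add]]; ring
    _ = 163 ^ Nm.primeFactors.card * (V' * vr) * D.deg := by rw [hcardNm, hk]

/-- **Real-cast form with the crux's product**: for every admissible `Nm` and every datum `D`,
`ξ(N/Nm, Nm) · ∏_{q ∣ Nm} v_q(Δ_min) ≤ 163^{ω(Nm)} · (∏_{q ∣ Nm} v_q(Δ_min))² · deg D` — the left
side of `XiStrongBound` against the left side of `FreyDegreeBound`.
[cite: Takahashi2001, Thm. 2.3 (p. 79), Thm. 3.2 (a) (p. 82)] [cite: PastenShimura2024, Lemma 6.8 p. 22, §6.9 p. 25] -/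
theorem brandtXi_mul_prod_le
    {a b : ℤ} (hab : IsCoprime a b) (h0 : a * b * (a + b) ≠ 0) {N : ℕ} [NeZero N]
    (hN : (freyCurve a b).conductorNorm ℤ = N) {Nm : ℕ} (hodd : Odd Nm) (hsq : Squarefree Nm)
    (hcard : Odd Nm.primeFactors.card) (hNmN : Nm ∣ N)
    (D : ModularParametrizationData (freyCurve a b) N) :
    (brandtXi (N / Nm) Nm (fun n => (freyCurve a b).LFunction n) : ℝ) *
        ∏ q ∈ Nm.primeFactors, ((((freyCurve a b).minimalDiscriminantNorm ℤ).factorization q : ℕ) : ℝ) ≤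
      (163 : ℝ) ^ Nm.primeFactors.card *
        (∏ q ∈ Nm.primeFactors, ((((freyCurve a b).minimalDiscriminantNorm ℤ).factorization q : ℕ) : ℝ)) ^ 2 *
        (D.deg : ℝ) := by
  have h := brandtXi_le_deg_mul_prod hTlev hT2 h68 hJL hab h0 hN hodd hsq hcard hNmN D
  set T := ∏ q ∈ Nm.primeFactors, ((freyCurve a b).minimalDiscriminantNorm ℤ).factorization q with hT
  have hT' : ∏ q ∈ Nm.primeFactors, ((((freyCurve a b).minimalDiscriminantNorm ℤ).factorization q : ℕ) : ℝ)
      = (T : ℝ) := by rw [hT, Nat.cast_prod]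
  rw [hT']
  have hR : (brandtXi (N / Nm) Nm (fun n => (freyCurve a b).LFunction n) : ℝ) ≤
      (163 : ℝ) ^ Nm.primeFactors.card * (T : ℝ) * (D.deg : ℝ) := by exact_mod_cast h
  calc (brandtXi (N / Nm) Nm (fun n => (freyCurve a b).LFunction n) : ℝ) * (T : ℝ)
      ≤ ((163 : ℝ) ^ Nm.primeFactors.card * (T : ℝ) * (D.deg : ℝ)) * (T : ℝ) :=
        mul_le_mul_of_nonneg_right hR (Nat.cast_nonneg _)
    _ = (163 : ℝ) ^ Nm.primeFactors.card * (T : ℝ) ^ 2 * (D.deg : ℝ) := by ring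

/-- **`FreyDegreeBound ⟹ XiStrongBound` at EVERY admissible `Nm`** (corner `N/Nm = 2^k` included), on
`hTlev`, `hT2`, Lemma 6.8, Jacquet–Langlands data: with the datum of `FreyDegreeBound` at `ε/4`,
`163^{ω(Nm)} ≤ C₁ N^{ε/4}` (divisor bound) and `∏_{q∣Nm} v_q(Δ_min) ≤ C₂ N^{ε/4}`
(`prod_factorization_le_rpow_of_polyFreyDegree`), `brandtXi_mul_prod_le` gives `ξ ∏ v_q ≤ C₁C₂²C₃ N^{2+ε}`.
The item's 'risk beyond abc' clause (Pasten 6.1 (a)) does not arise: only `i ≤ c`, `j ≥ 1` are used.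
[cite: Takahashi2001, Thm. 2.3 (p. 79), Thm. 3.2 (a) (p. 82)] [cite: PastenShimura2024, Lemma 6.8 p. 22, §6.9 p. 25] -/
theorem xiStrongBound_of_freyDegreeBound_of_facts (hX : FreyDegreeBound) : XiStrongBound := by
  intro ε hε
  have hε4 : 0 < ε / 4 := by positivity
  obtain ⟨C₁, -, hC₁⟩ := exists_pow_card_primeFactors_le hε4
  obtain ⟨C₂, hC₂⟩ := DefiniteXiXiBoundUpgradeSharpening.prod_factorization_le_rpow_of_polyFreyDegree
    (DefiniteXiPolyFreyDegree.polyFreyDegree_of_freyDegreeBound hX) (ε / 4) hε4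
  obtain ⟨C₃, hC₃⟩ := hX (ε / 4) hε4
  refine ⟨max C₁ 0 * (max C₂ 0) ^ 2 * max C₃ 0, fun a b hab h0 N _ hN Nm hodd hsq hcard hNmN => ?_⟩
  obtain ⟨D, hD⟩ := hC₃ a b hab h0 N hN
  have hmain := brandtXi_mul_prod_le hTlev hT2 h68 hJL hab h0 hN hodd hsq hcard hNmN D
  set T := ∏ q ∈ Nm.primeFactors, ((((freyCurve a b).minimalDiscriminantNorm ℤ).factorization q : ℕ) : ℝ) with hT
  have hN0 : (0 : ℝ) < (N : ℝ) := by exact_mod_cast NeZero.pos N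
  have hsub : Nm.primeFactors ⊆ N.primeFactors := Nat.primeFactors_mono hNmN (NeZero.ne N)
  have h1 : (163 : ℝ) ^ Nm.primeFactors.card ≤ max C₁ 0 * (N : ℝ) ^ (ε / 4) :=
    ((pow_le_pow_right₀ (by norm_num) (Finset.card_le_card hsub)).trans
      (hC₁ N (Nat.one_le_iff_ne_zero.mpr (NeZero.ne N)))).trans (by gcongr; exact le_max_left _ _)
  have hT0 : 0 ≤ T := by rw [hT]; positivity
  have h2 : T ≤ max C₂ 0 * (N : ℝ) ^ (ε / 4) :=
    (hC₂ a b hab h0 N hN Nm hodd).trans (by gcongr; exact le_max_left _ _)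
  have h2' : T ^ 2 ≤ (max C₂ 0 * (N : ℝ) ^ (ε / 4)) ^ 2 := pow_le_pow_left₀ hT0 h2 2
  have h3 : (D.deg : ℝ) ≤ max C₃ 0 * (N : ℝ) ^ (2 + ε / 4) := hD.trans (by gcongr; exact le_max_left _ _)
  have hpow : (N : ℝ) ^ (ε / 4) * ((N : ℝ) ^ (ε / 4)) ^ 2 * (N : ℝ) ^ (2 + ε / 4) =
      (N : ℝ) ^ (2 + ε) := by
    rw [← Real.rpow_natCast ((N : ℝ) ^ (ε / 4)) 2, ← Real.rpow_mul hN0.le, ← Real.rpow_add hN0,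
      ← Real.rpow_add hN0]
    norm_num; ring_nf
  calc (brandtXi (N / Nm) Nm (fun n => (freyCurve a b).LFunction n) : ℝ) * T
      ≤ (163 : ℝ) ^ Nm.primeFactors.card * T ^ 2 * (D.deg : ℝ) := hmain
    _ ≤ (max C₁ 0 * (N : ℝ) ^ (ε / 4)) * (max C₂ 0 * (N : ℝ) ^ (ε / 4)) ^ 2 *
          (max C₃ 0 * (N : ℝ) ^ (2 + ε / 4)) := by gcongr
    _ = max C₁ 0 * (max C₂ 0) ^ 2 * max C₃ 0 *
          ((N : ℝ) ^ (ε / 4) * ((N : ℝ) ^ (ε / 4)) ^ 2 * (N : ℝ) ^ (2 + ε / 4)) := by ring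
    _ = max C₁ 0 * (max C₂ 0) ^ 2 * max C₃ 0 * (N : ℝ) ^ (2 + ε) := by rw [hpow]

/-- **THE FULL-RUNG CALIBRATION: `XiStrongBound ⟺ FreyDegreeBound`** modulo `hTlev`, `hT2`, Lemma 6.8,
Jacquet–Langlands data, and the route items `DefiniteRTControlPrime` (r3; dischargeable by
`DefiniteRTControlPrime.definiteRTControlPrime_of_facts`) and `FreyModularity` (r9).  `⟹` is the landed
prime-rung chain (E₃), (E₁), `minimalBoundGivesTarget_proof` (= `…PrimeCalibration.freyDegreeBound_of_xiStrongBound`);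
`⟸` is `xiStrongBound_of_freyDegreeBound_of_facts`.  So the crux stmt-ABC-11337 is EXACTLY
thesis-strength at every rung: nothing at composite `N⁻` lies beyond `X`.
[cite: Takahashi2001, Thm. 2.3 (p. 79), Thm. 3.2 (a) (p. 82)] [cite: PastenShimura2024, Lemma 6.8 p. 22, §6.9 p. 25] -/
theorem xiStrongBound_iff_freyDegreeBound_of_facts
    (hRT : DefiniteRTControlPrime) (hMod : FreyModularity) : XiStrongBound ↔ FreyDegreeBound :=
  ⟨fun h => minimalBoundGivesTarget_proof hMod
      (DefiniteXiXiBoundUpgrade.minimalDegreeBound_of_primeXiStrongBound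
        (DefiniteXiXiBoundUpgrade.primeXiStrongBound_of_xiStrongBound h) hRT),
    xiStrongBound_of_freyDegreeBound_of_facts hTlev hT2 h68 hJL⟩

/-- **The full crux is equivalent to its prime rung** (same facts and route items): the composite-`N⁻`
instances, never consumed by `closes`, are also HARMLESS — they follow from the prime rung through `X`.
[cite: Takahashi2001, Thm. 2.3 (p. 79), Thm. 3.2 (a) (p. 82)] [cite: PastenShimura2024, Lemma 6.8 p. 22] -/
theorem xiStrongBound_iff_primeXiStrongBound_of_facts
    (hRT : DefiniteRTControlPrime) (hMod : FreyModularity) :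
    XiStrongBound ↔
      (∀ ε : ℝ, 0 < ε → ∃ C : ℝ, ∀ a b : ℤ, IsCoprime a b → a * b * (a + b) ≠ 0 →
        ∀ (N : ℕ) [NeZero N], (freyCurve a b).conductorNorm ℤ = N → ∀ q : ℕ, q.Prime → q ≠ 2 → q ∣ N →
          (brandtXi (N / q) q (fun n => (freyCurve a b).LFunction n) : ℝ) *
            ((((freyCurve a b).minimalDiscriminantNorm ℤ).factorization q : ℕ) : ℝ) ≤
              C * (N : ℝ) ^ (2 + ε)) :=
  ⟨DefiniteXiXiBoundUpgrade.primeXiStrongBound_of_xiStrongBound, fun h =>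
    xiStrongBound_of_freyDegreeBound_of_facts hTlev hT2 h68 hJL
      (minimalBoundGivesTarget_proof hMod
        (DefiniteXiXiBoundUpgrade.minimalDegreeBound_of_primeXiStrongBound h hRT))⟩

end Takahashi

/-- **Registered calibration sub-goal of stmt-ABC-11337 (line `SplitProof`, lead c20)**: `FreyDegreeBound → XiStrongBound`
modulo Takahashi 2001 Thm. 2.3 for Shimura curves on both sides, Lemma 6.8 and Jacquet–Langlands data — `xiStrongBound_of_freyDegreeBound_of_facts`
with the header fully qualified, verbatim the registered signature. [cite: Takahashi2001, Thm. 2.3 (p. 79), Thm. 3.2 (a) (p. 82)] [cite: PastenShimura2024, Lemma 6.8 p. 22, §6.9 p. 25] -/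
theorem xiStrongBound_of_freyDegreeBound_of_takahashi : (∀ {N D M p m : ℕ}, p.Prime → M = p * m → ¬ p ∣ m → Literature.NumberTheory.Automorphic.IsAdmissibleFactorization N D M → ∀ (X : Literature.NumberTheory.Automorphic.ShimuraCurveData D M) (W : WeierstrassCurve ℚ) [W.IsElliptic], W.conductorNorm ℤ = N → ∀ (W' : WeierstrassCurve ℚ) [W'.IsElliptic] (P : Literature.NumberTheory.Automorphic.ShimuraParametrizationData X W'), P.IsMinimalFor W → ∀ S : Literature.NumberTheory.Automorphic.Brandt.XiSetup m (D * p), ∃ i j : ℕ, 0 < i ∧ i * j = (W'.minimalDiscriminantNorm ℤ).factorization p ∧ i ∣ S.xi (fun n => W'.LFunction n) ∧ P.deg * i = S.xi (fun n => W'.LFunction n) * j) → (∀ {N D M p d : ℕ}, p.Prime → D = p * d → Literature.NumberTheory.Automorphic.IsAdmissibleFactorization N D M → ∀ (X : Literature.NumberTheory.Automorphic.ShimuraCurveData D M) (W : WeierstrassCurve ℚ) [W.IsElliptic], W.conductorNorm ℤ = N → ∀ (W' : WeierstrassCurve ℚ) [W'.IsElliptic] (P : Literature.NumberTheory.Automorphic.ShimuraParametrizationData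 X W'), P.IsMinimalFor W → ∀ S : Literature.NumberTheory.Automorphic.Brandt.XiSetup (p * M) d, ∃ i j : ℕ, 0 < i ∧ i * j = (W'.minimalDiscriminantNorm ℤ).factorization p ∧ i ∣ S.xi (fun n => W'.LFunction n) ∧ P.deg * i = S.xi (fun n => W'.LFunction n) * j) → Literature.NumberTheory.EllipticCurves.ModularForms.PastenShimura2024_lemma_6_8 → Literature.NumberTheory.Automorphic.nonempty_shimuraParametrizationData → Summit.ABC.ABC.Theses.DefiniteXi.FreyDegreeBound → Summit.ABC.ABC.Theses.DefiniteXi.XiStrongBound :=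
  fun hTlev hT2 h68 hJL => xiStrongBound_of_freyDegreeBound_of_facts hTlev hT2 h68 hJL

end Summit.ABC.ABC.Theorems.DefiniteXiXiStrongBoundDegreeCalibration

end
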